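import Literature.MathematicalPhysics.QuantumLattice.HubbardWave0
import Literature.MathematicalPhysics.QuantumLattice.FermionOperatorsProofs
import HarnessLib

/-!
# Discharges for the Hubbard wave-0 statements (`HubbardWave0`): Yang's extreme pair state

Family `hubbard` (trunk T-QLATTICE), statement hubbard.S07 (Yang's bound is attained). Sibling
proof file of `Literature/MathematicalPhysics/QuantumLattice/HubbardWave0.lean` (kept separate
from `HubbardWave0Proofs.lean`, the Fock-vacuum discharge, and from `FermionOperatorsProofs.lean`,
the CAR discharges, whose Jordan–Wigner sign lemmas and `annihilation_anticommute_holds` are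
imported): it proves a named fact (`def X : Prop`, D-0014) of that file from Mathlib and the two
sibling proof files alone. No statement or definition is introduced or changed here; the proof
devices (the adjacent pairing `lo, hi`, the orbital sets `P T` of sets of pairs, the pair states
`Ψ n`, the pair-annihilation matrix `A`) are section variables with defining hypotheses,
instantiated by `rfl` in the final proof, and all auxiliary lemmas live in the namespace
`Literature.Hubbard.YangODLRO`.

Proved here:

* `Literature.Hubbard.exists_twoParticleRDM_rayleigh_eq_holds : exists_twoParticleRDM_rayleigh_eq` —
  hubbard.S07, the "extreme ODLRO" half of Yang's theorem: for `M = |ι| ≥ 2` even, `N ≤ M`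
  even, some normalised `N`-fermion state `ψ` and unit pair wavefunction `v` have
  `Re ⟨v, ρ₂(ψ) v⟩ = N(M - N + 2)/M` [cite: YangODLRO1962, §3].

## Source

C. N. Yang, *Concept of off-diagonal long-range order and the quantum phases of liquid He and of
superconductors*, Rev. Mod. Phys. **34** (1962) 694–704, §3: the bound `λ ≤ N(M - N + 2)/M` on
the largest eigenvalue `λ` of `ρ₂` for `N` fermions in `M` orbitals (`M`, `N` even), attained
by the pair condensate `(Σ_k a†_{2k-1} a†_{2k})^{N/2} |0⟩` (cite locator as in the vendored
statement `[cite: YangODLRO1962, §3]`; the paper itself is paywalled and not held — an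
acquisition request is filed — so the construction below was re-derived; the extremal pairing
`ω = Σ_i e_{2i-1} ∧ e_{2i}` is also restated in the held secondary source
arXiv:1409.3931, p. 4).

## Proof sketch (`exists_twoParticleRDM_rayleigh_eq_holds`)

Write `M = 2Ω`, `N = 2n` and pair the orbitals adjacently along the order isomorphism
`Fin (2Ω) ≃o ι`: `lo k < hi k < lo (k+1) < ⋯`. For these matrices
`ρ₂(p, q) = ⟨c_{p₂} c_{p₁} ψ, c_{q₂} c_{q₁} ψ⟩`, so `ρ₂ = Aᴴ A` for the matrix `A` whose
column `q` is `c_{q₂} c_{q₁} ψ` (`twoParticleRDM_eq_conjTranspose_mul`), and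
`⟨v, ρ₂ v⟩ = ‖A v‖²` (`star_dotProduct_twoParticleRDM_mulVec`). Take
`ψ ∝ Ψ n = Σ_{|T| = n} |P T⟩`, `P T = ⋃_{k ∈ T} {lo k, hi k}` (the sum of the occupation basis
vectors of all unions of `n` pairs, i.e. `(b†)ⁿ |0⟩ / n!`, `b† = Σ_k c†_{lo k} c†_{hi k}`) and
`v = (2Ω)^{-1/2} Σ_k (δ_{(lo k, hi k)} - δ_{(hi k, lo k)})`. Adjacency makes every Jordan–Wigner
sign `+1`: `c_{hi k} c_{lo k} |P T⟩ = [k ∈ T] |P (T ∖ k)⟩` (`annihilation_hi_lo_single`),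
whence by double counting `b (Ψ (m+1)) = (Ω - m) Ψ m` (`sum_annihilation_hi_lo_pairState`),
and `A v = 2 (2Ω)^{-1/2} b ψ` by the CAR (`mulVec_pairVec`). With `‖Ψ m‖² = C(Ω, m)`
(`pairState_dotProduct_pairState`) and `C(Ω, m) (Ω - m) = C(Ω, m+1) (m+1)` this gives
`‖A v‖² = 4 (m+1) (Ω - m) / (2Ω) = N (M - N + 2) / M` for `N = 2(m+1)`; for `N = 0` both sides
vanish.
-/

namespace Literature.MathematicalPhysics.QuantumLattice

open Matrix Finset
open scoped ComplexOrder

namespace YangODLRO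

/-! ### Entry formulas and the vector form of the CAR -/

section Fock

variable {ι : Type*} [LinearOrder ι] [Fintype ι]

/-- Entry formula: `(c_i ψ)(s) = [i ∉ s] · jwSign i s · ψ(s ∪ {i})`.
Bratteli–Robinson II §5.2.2. [folklore] -/
theorem annihilation_mulVec_apply (i : ι) (ψ : Fock ι) (s : Finset ι) :
    (annihilation i *ᵥ ψ) s = if i ∉ s then jwSign i s * ψ (insert i s) else 0 := by
  simp only [Matrix.mulVec, dotProduct, annihilation]
  by_cases hi : i ∈ s
  · simp [hi]
  · simp [hi]

/-- Entry formula for the product `c_i c_j`. Bratteli–Robinson II §5.2.2. [folklore] -/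
theorem annihilation_mul_apply (i j : ι) (s u : Finset ι) :
    (annihilation i * annihilation j) s u =
      if i ∉ s ∧ j ∉ insert i s ∧ u = insert j (insert i s) then
        jwSign i s * jwSign j (insert i s) else 0 := by
  simp only [Matrix.mul_apply, annihilation]
  by_cases hi : i ∈ s
  · simp [hi]
  · simp only [hi, not_false_eq_true, true_and, ite_mul, zero_mul]
    rw [Finset.sum_ite_eq']
    simp only [Finset.mem_univ, if_true]
    by_cases hj : j ∉ insert i s ∧ u = insert j (insert i s)
    · simp [hj]
    · simp

/-- Vector form of the pure CAR: `c_i (c_j ψ) = - c_j (c_i ψ)`. Bratteli–Robinson II §5.2.2.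
[folklore] -/
theorem annihilation_mulVec_annihilation_mulVec (i j : ι) (ψ : Fock ι) :
    annihilation i *ᵥ (annihilation j *ᵥ ψ) = -(annihilation j *ᵥ (annihilation i *ᵥ ψ)) := by
  rw [Matrix.mulVec_mulVec, Matrix.mulVec_mulVec, ← Matrix.neg_mulVec,
    eq_neg_of_add_eq_zero_left (annihilation_anticommute_holds i j)]

/-! ### `ρ₂` is a Gram matrix -/

section Gram

variable (ψ : Fock ι) {A : Matrix (Finset ι) (ι × ι) ℂ}
  (hA : A = Matrix.of fun s q => (annihilation q.2 *ᵥ (annihilation q.1 *ᵥ ψ)) s)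
include hA

/-- `ρ₂ = Aᴴ A` for the matrix `A` whose column `q = (q₁, q₂)` is the pair-annihilated vector
`c_{q₂} c_{q₁} ψ`, i.e. `ρ₂(p, q) = ⟨c_{p₂} c_{p₁} ψ, c_{q₂} c_{q₁} ψ⟩`. Yang (1962) §3.
[folklore] -/
theorem twoParticleRDM_eq_conjTranspose_mul : twoParticleRDM ψ = Aᴴ * A := by
  subst hA
  ext p q
  simp only [twoParticleRDM, expect, creation]
  rw [mul_assoc, ← conjTranspose_mul, ← mulVec_mulVec, dotProduct_mulVec, vecMul_conjTranspose,
    star_star, ← mulVec_mulVec, ← mulVec_mulVec, Matrix.mul_apply]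
  rfl

/-- The Rayleigh quotient of `ρ₂` is a squared norm: `⟨v, ρ₂ v⟩ = ‖A v‖²`,
`A v = Σ_q v(q) c_{q₂} c_{q₁} ψ`. Yang (1962) §3. [folklore] -/
theorem star_dotProduct_twoParticleRDM_mulVec (v : ι × ι → ℂ) :
    star v ⬝ᵥ (twoParticleRDM ψ *ᵥ v) = star (A *ᵥ v) ⬝ᵥ (A *ᵥ v) := by
  rw [twoParticleRDM_eq_conjTranspose_mul ψ hA, ← mulVec_mulVec, dotProduct_mulVec,
    vecMul_conjTranspose, star_star]

/-- On Yang's pair wavefunction `w = Σ_k a (δ_{(lo k, hi k)} - δ_{(hi k, lo k)})` attached to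
`Ω` pairs of orbitals `(lo k, hi k)`, `A w = 2a · Σ_k c_{hi k} c_{lo k} ψ`, by the pure CAR
(`annihilation_mulVec_annihilation_mulVec`). Yang (1962) §3. [folklore] -/
theorem mulVec_pairVec {Ω : ℕ} (lo hi : Fin Ω → ι) (a : ℂ) {w : ι × ι → ℂ}
    (hw : w = ∑ k : Fin Ω, (Pi.single (lo k, hi k) a - Pi.single (hi k, lo k) a)) :
    A *ᵥ w = (2 * a) • ∑ k, annihilation (hi k) *ᵥ (annihilation (lo k) *ᵥ ψ) := by
  subst hw
  simp only [mulVec_sum, mulVec_sub, mulVec_single, op_smul_eq_smul, smul_sum]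
  refine sum_congr rfl fun k _ => ?_
  have h1 : A.col (lo k, hi k) = annihilation (hi k) *ᵥ (annihilation (lo k) *ᵥ ψ) := by
    subst hA
    rfl
  have h2 : A.col (hi k, lo k) = -(annihilation (hi k) *ᵥ (annihilation (lo k) *ᵥ ψ)) := by
    subst hA
    exact annihilation_mulVec_annihilation_mulVec _ _ _
  rw [h1, h2, smul_neg, sub_neg_eq_add, ← two_smul ℂ, smul_smul, mul_comm]

end Gram

end Fock

/-! ### Adjacent pairings and Yang's pair state

Throughout, `lo hi : Fin Ω → ι` is an *adjacent pairing* of `Ω` pairs of orbitals: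
`lo k < hi k` (`hlh`) and `hi k < lo k'` for `k < k'` (`hhl`), so that no orbital lies strictly
between the two members of a pair (Yang (1962) §3 pairs the states `2k - 1, 2k`). The proof
devices are kept as variables with defining hypotheses (no auxiliary definitions):
`P T = ⋃_{k ∈ T} {lo k, hi k}` (`hP`), the orbital set of the pairs `T`, and
`Ψ n = Σ_{|T| = n} |P T⟩` (`hΨ`), Yang's unnormalised `n`-pair state `(b†)ⁿ |0⟩ / n!`,
`b† = Σ_k c†_{lo k} c†_{hi k}`. -/

section Pairing

variable {ι : Type*} [LinearOrder ι] {Ω : ℕ} {lo hi : Fin Ω → ι}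
  (hlh : ∀ k, lo k < hi k) (hhl : ∀ ⦃k k' : Fin Ω⦄, k < k' → hi k < lo k')

section Order
include hlh hhl

/-- The lower members of an adjacent pairing increase. [folklore] -/
theorem pairing_lo_strictMono : StrictMono lo := fun _ _ hk => (hlh _).trans (hhl hk)

/-- The upper members of an adjacent pairing increase. [folklore] -/
theorem pairing_hi_strictMono : StrictMono hi := fun _ _ hk => (hhl hk).trans (hlh _)

/-- No lower member is an upper member. [folklore] -/
theorem pairing_lo_ne_hi (k k' : Fin Ω) : lo k ≠ hi k' := by
  rcases le_or_gt k k' with hk | hk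
  · exact (((pairing_lo_strictMono hlh hhl).monotone hk).trans_lt (hlh k')).ne
  · exact (hhl hk).ne'

/-- `hi k < lo k'` exactly when `k < k'`. [folklore] -/
theorem pairing_hi_lt_lo_iff {k k' : Fin Ω} : hi k < lo k' ↔ k < k' := by
  refine ⟨fun hlt => ?_, fun hk => hhl hk⟩
  by_contra hk
  exact lt_asymm (((pairing_lo_strictMono hlh hhl).monotone (not_lt.mp hk)).trans_lt (hlh k)) hlt

/-- For distinct pairs, `lo k < hi k'` exactly when `k < k'`. [folklore] -/
theorem pairing_lo_lt_hi_iff_of_ne {k k' : Fin Ω} (hne : k ≠ k') : lo k < hi k' ↔ k < k' := by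
  refine ⟨fun hlt => ?_, fun hk => (pairing_lo_strictMono hlh hhl hk).trans (hlh k')⟩
  rcases lt_or_gt_of_ne hne with hk | hk
  · exact hk
  · exact absurd (hhl hk) (lt_asymm hlt)

end Order

variable {P : Finset (Fin Ω) → Finset ι} (hP : ∀ T, P T = T.image lo ∪ T.image hi)

section PairSet
include hP

/-- Adding a pair adds its two orbitals. [folklore] -/
theorem pairSet_insert (T : Finset (Fin Ω)) (k : Fin Ω) :
    P (insert k T) = insert (lo k) (insert (hi k) (P T)) := by
  simp only [hP, image_insert, insert_union, union_insert]
  exact Finset.insert_comm _ _ _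

include hlh hhl

/-- `lo k` is occupied in `P T` iff the pair `k` is present. [folklore] -/
theorem lo_mem_pairSet {T : Finset (Fin Ω)} {k : Fin Ω} : lo k ∈ P T ↔ k ∈ T := by
  simp only [hP, mem_union, mem_image]
  constructor
  · rintro (⟨k', hk', hkk'⟩ | ⟨k', hk', hkk'⟩)
    · rwa [← (pairing_lo_strictMono hlh hhl).injective hkk']
    · exact absurd hkk'.symm (pairing_lo_ne_hi hlh hhl k k')
  · exact fun hk => Or.inl ⟨k, hk, rfl⟩

/-- `hi k` is occupied in `P T` iff the pair `k` is present. [folklore] -/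
theorem hi_mem_pairSet {T : Finset (Fin Ω)} {k : Fin Ω} : hi k ∈ P T ↔ k ∈ T := by
  simp only [hP, mem_union, mem_image]
  constructor
  · rintro (⟨k', hk', hkk'⟩ | ⟨k', hk', hkk'⟩)
    · exact absurd hkk' (pairing_lo_ne_hi hlh hhl k' k)
    · rwa [← (pairing_hi_strictMono hlh hhl).injective hkk']
  · exact fun hk => Or.inr ⟨k, hk, rfl⟩

/-- `P T` has `2 |T|` orbitals. [folklore] -/
theorem card_pairSet (T : Finset (Fin Ω)) : (P T).card = T.card + T.card := by
  rw [hP, card_union_of_disjoint,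
    card_image_of_injective _ (pairing_lo_strictMono hlh hhl).injective,
    card_image_of_injective _ (pairing_hi_strictMono hlh hhl).injective]
  exact disjoint_left.mpr fun x hx hx' => by
    obtain ⟨k, -, rfl⟩ := mem_image.mp hx
    obtain ⟨k', -, hk'⟩ := mem_image.mp hx'
    exact pairing_lo_ne_hi hlh hhl k k' hk'.symm

/-- Distinct sets of pairs occupy distinct sets of orbitals. [folklore] -/
theorem pairSet_injective : Function.Injective P := fun T T' hTT' => by
  ext k
  rw [← lo_mem_pairSet hlh hhl hP, hTT', lo_mem_pairSet hlh hhl hP]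

/-- The orbitals of `P T` below `lo k` are those of the pairs below `k`. [folklore] -/
theorem pairSet_filter_lt_lo (T : Finset (Fin Ω)) (k : Fin Ω) :
    (P T).filter (· < lo k) = P (T.filter (· < k)) := by
  simp only [hP, filter_union, filter_image]
  congr 2
  · exact filter_congr fun k' _ => by simp [(pairing_lo_strictMono hlh hhl).lt_iff_lt]
  · exact filter_congr fun k' _ => by simp [pairing_hi_lt_lo_iff hlh hhl]

/-- If the pair `k` is absent, the orbitals of `P T` below `hi k` are those of the pairs below
`k`. [folklore] -/
theorem pairSet_filter_lt_hi (T : Finset (Fin Ω)) {k : Fin Ω} (hk : k ∉ T) :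
    (P T).filter (· < hi k) = P (T.filter (· < k)) := by
  simp only [hP, filter_union, filter_image]
  congr 2
  · exact filter_congr fun k' hk' => by
      simp [pairing_lo_lt_hi_iff_of_ne hlh hhl (ne_of_mem_of_not_mem hk' hk)]
  · exact filter_congr fun k' _ => by simp [(pairing_hi_strictMono hlh hhl).lt_iff_lt]

/-- Below `lo k`, a union of pairs has an even number of orbitals, so the Jordan–Wigner sign of
`c_{lo k}` on `|P T⟩` is `+1`. Yang (1962) §3. [folklore] -/
theorem jwSign_lo_pairSet (T : Finset (Fin Ω)) (k : Fin Ω) : jwSign (lo k) (P T) = 1 := by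
  rw [jwSign, pairSet_filter_lt_lo hlh hhl hP, card_pairSet hlh hhl hP, Even.neg_one_pow ⟨_, rfl⟩]

/-- Below `hi k`, a union of pairs not containing the pair `k` has an even number of orbitals,
so the Jordan–Wigner sign of `c_{hi k}` is `+1` there. Yang (1962) §3. [folklore] -/
theorem jwSign_hi_pairSet (T : Finset (Fin Ω)) {k : Fin Ω} (hk : k ∉ T) :
    jwSign (hi k) (P T) = 1 := by
  rw [jwSign, pairSet_filter_lt_hi hlh hhl hP T hk, card_pairSet hlh hhl hP,
    Even.neg_one_pow ⟨_, rfl⟩]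

variable [Fintype ι]

/-- `c_{hi k} c_{lo k}` removes the pair `k` from the basis vector `|P T⟩` (with sign `+1`,
thanks to the adjacency of the pairing) and kills it if the pair is absent. Yang (1962) §3.
[folklore] -/
theorem annihilation_hi_lo_single (T : Finset (Fin Ω)) (k : Fin Ω) :
    annihilation (hi k) *ᵥ (annihilation (lo k) *ᵥ Pi.single (P T) (1 : ℂ)) =
      if k ∈ T then Pi.single (P (T.erase k)) 1 else 0 := by
  ext t
  rw [annihilation_mulVec_apply, annihilation_mulVec_apply]
  have hlo' : ∀ T' : Finset (Fin Ω), k ∉ T' → lo k ∉ insert (hi k) (P T') :=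
    fun T' hk => by simp [pairing_lo_ne_hi hlh hhl, lo_mem_pairSet hlh hhl hP, hk]
  have hhi' : ∀ T' : Finset (Fin Ω), k ∉ T' → hi k ∉ P T' := fun T' hk => by
    simp [hi_mem_pairSet hlh hhl hP, hk]
  -- the two vanishing branches first
  by_cases h1 : hi k ∉ t
  swap
  · rw [if_neg h1]
    by_cases hkT : k ∈ T
    · rw [if_pos hkT, Pi.single_eq_of_ne]
      rintro rfl
      exact h1 (hhi' _ (notMem_erase k T))
    · rw [if_neg hkT]
      rfl
  rw [if_pos h1]
  by_cases h2 : lo k ∉ insert (hi k) t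
  swap
  · rw [if_neg h2, mul_zero]
    by_cases hkT : k ∈ T
    · rw [if_pos hkT, Pi.single_eq_of_ne]
      rintro rfl
      exact h2 (hlo' _ (notMem_erase k T))
    · rw [if_neg hkT]
      rfl
  rw [if_pos h2]
  -- main branch: `hi k ∉ t`, `lo k ∉ t`
  by_cases hkT : k ∈ T
  · rw [if_pos hkT]
    have hPT : P T = insert (lo k) (insert (hi k) (P (T.erase k))) := by
      rw [← pairSet_insert hP, insert_erase hkT]
    by_cases ht : t = P (T.erase k)
    · subst ht
      rw [← hPT, Pi.single_eq_same, Pi.single_eq_same,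
        jwSign_insert_of_not_lt (not_lt.mpr (hlh k).le), jwSign_lo_pairSet hlh hhl hP,
        jwSign_hi_pairSet hlh hhl hP _ (notMem_erase k T)]
      ring
    · rw [Pi.single_eq_of_ne ht, Pi.single_eq_of_ne, mul_zero, mul_zero]
      intro hE
      apply ht
      calc t = (insert (hi k) t).erase (hi k) := (erase_insert h1).symm
        _ = ((insert (lo k) (insert (hi k) t)).erase (lo k)).erase (hi k) := by
            rw [erase_insert h2]
        _ = P (T.erase k) := by
            rw [hE, hPT, erase_insert (hlo' _ (notMem_erase k T)),
              erase_insert (hhi' _ (notMem_erase k T))]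
  · rw [if_neg hkT, Pi.zero_apply, Pi.single_eq_of_ne, mul_zero, mul_zero]
    intro hE
    apply hkT
    rw [← lo_mem_pairSet hlh hhl hP (T := T), ← hE]
    exact mem_insert_self _ _

end PairSet

section PairState

variable {Ψ : ℕ → Fock ι}
  (hΨ : ∀ n, Ψ n = ∑ T ∈ powersetCard n (univ : Finset (Fin Ω)), Pi.single (P T) (1 : ℂ))
include hΨ

/-- The pair state has real coefficients. [folklore] -/
theorem star_pairState (n : ℕ) : star (Ψ n) = Ψ n := by
  simp only [hΨ, star_sum, ← Pi.single_star, star_one]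

include hlh hhl hP

/-- The `n`-pair state is supported on `2n`-element orbital sets. [folklore] -/
theorem pairState_apply_eq_zero {n : ℕ} {s : Finset ι} (hs : s.card ≠ n + n) : Ψ n s = 0 := by
  rw [hΨ, Finset.sum_apply]
  refine Finset.sum_eq_zero fun T hT => Pi.single_eq_of_ne ?_ _
  rintro rfl
  rw [card_pairSet hlh hhl hP, (mem_powersetCard.mp hT).2] at hs
  exact hs rfl

/-- The `n`-pair state lies in the `2n`-particle sector. Yang (1962) §3. [folklore] -/
theorem isNParticle_pairState (n : ℕ) : IsNParticle (n + n) (Ψ n) :=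
  fun _ hs => pairState_apply_eq_zero hlh hhl hP hΨ hs

variable [Fintype ι]

/-- `‖Σ_{|T| = n} |P T⟩‖² = C(Ω, n)` (the `|P T⟩` are orthonormal). Yang (1962) §3.
[folklore] -/
theorem pairState_dotProduct_pairState (n : ℕ) : star (Ψ n) ⬝ᵥ Ψ n = (Ω.choose n : ℂ) := by
  rw [star_pairState hΨ, hΨ, sum_dotProduct]
  simp only [dotProduct_sum, single_dotProduct, one_mul, Pi.single_apply,
    (pairSet_injective hlh hhl hP).eq_iff, sum_ite_eq, sum_extend_by_zero, sum_const,
    card_powersetCard, card_univ, Fintype.card_fin, nsmul_eq_mul, mul_one]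

/-- The pair annihilator `b = Σ_k c_{hi k} c_{lo k}` maps the `(m+1)`-pair state to `Ω - m`
times the `m`-pair state (double counting of `(T, k ∈ T)`). Yang (1962) §3. [folklore] -/
theorem sum_annihilation_hi_lo_pairState (m : ℕ) :
    ∑ k, annihilation (hi k) *ᵥ (annihilation (lo k) *ᵥ Ψ (m + 1)) =
      ((Ω - m : ℕ) : ℂ) • Ψ m := by
  have step1 : ∀ k : Fin Ω,
      annihilation (hi k) *ᵥ (annihilation (lo k) *ᵥ Ψ (m + 1)) =
        ∑ T ∈ powersetCard m (univ : Finset (Fin Ω)),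
          if k ∉ T then Pi.single (P T) (1 : ℂ) else 0 := by
    intro k
    rw [hΨ, mulVec_sum, mulVec_sum]
    simp only [annihilation_hi_lo_single hlh hhl hP]
    rw [← sum_filter, ← sum_filter]
    refine sum_nbij' (fun T => T.erase k) (fun T => insert k T) ?_ ?_ ?_ ?_ ?_
    · intro T hT
      simp only [mem_filter, mem_powersetCard] at hT ⊢
      exact ⟨⟨subset_univ _, by rw [card_erase_of_mem hT.2, hT.1.2]; rfl⟩, notMem_erase k T⟩
    · intro T hT
      simp only [mem_filter, mem_powersetCard] at hT ⊢
      exact ⟨⟨subset_univ _, by rw [card_insert_of_notMem hT.2, hT.1.2]⟩, mem_insert_self k T⟩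
    · intro T hT
      simp only [mem_filter] at hT
      exact insert_erase hT.2
    · intro T hT
      simp only [mem_filter] at hT
      exact erase_insert hT.2
    · intro T _
      rfl
  simp only [step1]
  rw [sum_comm, hΨ, smul_sum]
  refine sum_congr rfl fun T hT => ?_
  rw [← sum_filter, sum_const]
  have : (univ.filter fun k => k ∉ T).card = Ω - m := by
    rw [filter_not, filter_mem_eq_inter, univ_inter, ← compl_eq_univ_sdiff, card_compl,
      (mem_powersetCard.mp hT).2, Fintype.card_fin]
  rw [this, ← Nat.cast_smul_eq_nsmul ℂ]

/-- `b` kills the vacuum (the `0`-pair state). [folklore] -/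
theorem sum_annihilation_hi_lo_pairState_zero :
    ∑ k, annihilation (hi k) *ᵥ (annihilation (lo k) *ᵥ Ψ 0) = 0 := by
  refine sum_eq_zero fun k _ => ?_
  rw [hΨ, powersetCard_zero, sum_singleton, annihilation_hi_lo_single hlh hhl hP,
    if_neg (notMem_empty k)]

end PairState

include hlh hhl in
/-- `‖Σ_k a (δ_{(lo k, hi k)} - δ_{(hi k, lo k)})‖² = 2Ω |a|²` (the `2Ω` ordered pairs
`(lo k, hi k)`, `(hi k, lo k)` are distinct). Yang (1962) §3. [folklore] -/
theorem star_pairVec_dotProduct_pairVec [Fintype ι] (a : ℂ) {w : ι × ι → ℂ}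
    (hw : w = ∑ k : Fin Ω, (Pi.single (lo k, hi k) a - Pi.single (hi k, lo k) a)) :
    star w ⬝ᵥ w = ((Ω + Ω : ℕ) : ℂ) * (star a * a) := by
  have hstar : star w = ∑ k : Fin Ω, (Pi.single (lo k, hi k) (star a) -
      Pi.single (hi k, lo k) (star a)) := by
    simp only [hw, star_sum, star_sub, ← Pi.single_star]
  have hne' : ∀ k k', hi k ≠ lo k' := fun k k' => (pairing_lo_ne_hi hlh hhl k' k).symm
  rw [hstar, hw, sum_dotProduct]
  simp only [dotProduct_sum, sub_dotProduct, dotProduct_sub, single_dotProduct, Pi.single_apply,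
    Prod.mk.injEq, (pairing_lo_strictMono hlh hhl).injective.eq_iff,
    (pairing_hi_strictMono hlh hhl).injective.eq_iff, pairing_lo_ne_hi hlh hhl, hne', and_self,
    if_false, mul_ite, mul_zero, sub_zero, zero_sub, sub_neg_eq_add]
  simp only [sum_add_distrib, sum_ite_eq, mem_univ, if_true, sum_const, card_univ,
    Fintype.card_fin, nsmul_eq_mul, Nat.cast_add]
  ring

end Pairing
end YangODLRO

/-! ### Yang's theorem: the bound is attained -/

section Main

open YangODLRO

variable {ι : Type*} [LinearOrder ι] [Fintype ι]

/-- **Discharge of `Literature.MathematicalPhysics.QuantumLattice.exists_twoParticleRDM_rayleigh_eq` (hubbard.S07, Yang's bound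
is attained).** For `M = |ι| ≥ 2` even and `N ≤ M` even there are a
normalised `N`-fermion state `ψ` (Yang's pair condensate `(Σ_k c†_{lo k} c†_{hi k})^{N/2} |0⟩`,
normalised) and a unit pair wavefunction `v` (the antisymmetrised, normalised indicator of the
pairs) with `Re ⟨v, ρ₂(ψ) v⟩ = N (M - N + 2) / M`, the maximal value allowed by Yang's bound
`twoParticleRDM_rayleigh_le`. Yang, Rev. Mod. Phys. 34 (1962) 694, §3.
[cite: YangODLRO1962, §3] -/
theorem exists_twoParticleRDM_rayleigh_eq_holds : exists_twoParticleRDM_rayleigh_eq (ι := ι) := by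
  intro N hN hM hM2 hNM
  obtain ⟨n, rfl⟩ := hN
  obtain ⟨Ω, hΩ⟩ := hM
  -- the adjacent pairing `lo k = e (2k) < hi k = e (2k+1)` along `e : Fin (Ω + Ω) ≃o ι`
  let e := Fintype.orderIsoFinOfCardEq ι hΩ
  let lo : Fin Ω → ι := fun k => e ⟨2 * k, by omega⟩
  let hi : Fin Ω → ι := fun k => e ⟨2 * k + 1, by omega⟩
  have hlh : ∀ k, lo k < hi k := fun k => e.strictMono (Fin.mk_lt_mk.mpr (by omega))
  have hhl : ∀ ⦃k k' : Fin Ω⦄, k < k' → hi k < lo k' := fun k k' hk =>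
    e.strictMono (Fin.mk_lt_mk.mpr (by have := Fin.lt_def.mp hk; omega))
  -- the proof devices: orbital sets of pairs, pair states, pair-annihilation matrices
  let P : Finset (Fin Ω) → Finset ι := fun T => T.image lo ∪ T.image hi
  have hP : ∀ T, P T = T.image lo ∪ T.image hi := fun T => rfl
  let Ψ : ℕ → Fock ι := fun n => ∑ T ∈ powersetCard n (univ : Finset (Fin Ω)), Pi.single (P T) 1
  have hΨ : ∀ n, Ψ n = ∑ T ∈ powersetCard n (univ : Finset (Fin Ω)), Pi.single (P T) 1 :=
    fun n => rfl
  let A : Fock ι → Matrix (Finset ι) (ι × ι) ℂ := fun ψ =>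
    Matrix.of fun s q => (annihilation q.2 *ᵥ (annihilation q.1 *ᵥ ψ)) s
  have hA : ∀ ψ, A ψ = Matrix.of fun s q => (annihilation q.2 *ᵥ (annihilation q.1 *ᵥ ψ)) s :=
    fun ψ => rfl
  have hΩ0 : 0 < Ω := by omega
  -- the pair wavefunction, normalised
  set α : ℝ := (Real.sqrt (Ω + Ω : ℕ))⁻¹ with hα
  have hα2 : α ^ 2 * (Ω + Ω : ℕ) = 1 := by
    rw [hα, inv_pow, Real.sq_sqrt (Nat.cast_nonneg _), inv_mul_cancel₀]
    positivity
  let w : ι × ι → ℂ :=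
    ∑ k : Fin Ω, (Pi.single (lo k, hi k) (α : ℂ) - Pi.single (hi k, lo k) (α : ℂ))
  have hw : w = ∑ k : Fin Ω, (Pi.single (lo k, hi k) (α : ℂ) - Pi.single (hi k, lo k) (α : ℂ)) :=
    rfl
  have hv : star w ⬝ᵥ w = 1 := by
    rw [star_pairVec_dotProduct_pairVec hlh hhl α hw, Complex.star_def, Complex.conj_ofReal]
    exact_mod_cast (show ((Ω + Ω : ℕ) : ℝ) * (α * α) = 1 by rw [← hα2]; ring)
  rcases n with _ | m
  · -- `N = 0`: the vacuum, both sides vanish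
    refine ⟨Ψ 0, isNParticle_pairState hlh hhl hP hΨ 0, ?_, w, hv, ?_⟩
    · rw [pairState_dotProduct_pairState hlh hhl hP hΨ, Nat.choose_zero_right, Nat.cast_one]
    · rw [star_dotProduct_twoParticleRDM_mulVec _ (hA _), mulVec_pairVec _ (hA _) lo hi α hw,
        sum_annihilation_hi_lo_pairState_zero hlh hhl hP hΨ, smul_zero, star_zero,
        zero_dotProduct]
      simp
  · -- `N = 2(m+1)`
    have hmΩ : m < Ω := by omega
    have hchoose : 0 < Ω.choose (m + 1) := Nat.choose_pos (by omega)
    set c : ℝ := (Real.sqrt (Ω.choose (m + 1) : ℕ))⁻¹ with hc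
    have hc2 : c ^ 2 * (Ω.choose (m + 1) : ℕ) = 1 := by
      rw [hc, inv_pow, Real.sq_sqrt (Nat.cast_nonneg _), inv_mul_cancel₀]
      positivity
    refine ⟨(c : ℂ) • Ψ (m + 1), ?_, ?_, w, hv, ?_⟩
    · intro s hs
      rw [Pi.smul_apply, pairState_apply_eq_zero hlh hhl hP hΨ hs, smul_zero]
    · rw [star_smul, smul_dotProduct, dotProduct_smul,
        pairState_dotProduct_pairState hlh hhl hP hΨ, Complex.star_def, Complex.conj_ofReal,
        smul_eq_mul, smul_eq_mul]
      exact_mod_cast (show c * (c * ((Ω.choose (m + 1) : ℕ) : ℝ)) = 1 by rw [← hc2]; ring)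
    · rw [star_dotProduct_twoParticleRDM_mulVec _ (hA _), mulVec_pairVec _ (hA _) lo hi α hw]
      simp_rw [mulVec_smul]
      rw [← smul_sum, sum_annihilation_hi_lo_pairState hlh hhl hP hΨ m, smul_smul, smul_smul,
        star_smul, smul_dotProduct, dotProduct_smul,
        pairState_dotProduct_pairState hlh hhl hP hΨ]
      have hE : star (2 * (α : ℂ) * (c : ℂ) * ((Ω - m : ℕ) : ℂ)) •
          ((2 * (α : ℂ) * (c : ℂ) * ((Ω - m : ℕ) : ℂ)) • ((Ω.choose m : ℕ) : ℂ)) =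
            ((4 * α ^ 2 * c ^ 2 * ((Ω - m : ℕ) : ℝ) ^ 2 * (Ω.choose m : ℕ) : ℝ) : ℂ) := by
        simp only [smul_eq_mul, Complex.star_def, map_mul, Complex.conj_ofReal, map_natCast,
          map_ofNat]
        push_cast
        ring
      have key : (Ω.choose m : ℝ) * ((Ω - m : ℕ) : ℝ) =
          (Ω.choose (m + 1) : ℝ) * ((m + 1 : ℕ) : ℝ) := by
        exact_mod_cast (Nat.choose_succ_right_eq Ω m).symm
      rw [hE, Complex.ofReal_re, hΩ, eq_div_iff (show ((Ω + Ω : ℕ) : ℝ) ≠ 0 by positivity)]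
      push_cast [Nat.cast_sub hmΩ.le] at key hα2 ⊢
      linear_combination (4 * c ^ 2 * ((Ω : ℝ) - m) ^ 2 * (Ω.choose m : ℝ)) * hα2 +
        (4 * c ^ 2 * ((Ω : ℝ) - m)) * key + (4 * ((Ω : ℝ) - m) * ((m : ℝ) + 1)) * hc2

end Main

end Literature.MathematicalPhysics.QuantumLattice
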